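import Summits.CriticalPhenomena.Ising3DConformalLimit.Theses.FKParityRobustness
import Summits.CriticalPhenomena.Ising3DConformalLimit.Theorems.FKParityRobustnessSourceTrailsMeet
import Literature.Probability.LatticeModels.GKSInequalities
import Literature.Probability.LatticeModels.ModifiedSimonInequality
import Literature.Probability.LatticeModels.IsingThermodynamics
import Literature.Combinatorics.SimpleGraph.CycleSpaceSeparators
import HarnessLib

/-!
# `ShadowGivesJoin` (stmt-CriticalPhenomena-14649): the depletion bound and the strand shadow
# give the joining of two independent strands

Route `FKParityRobustness`, sub-problem `Ising3DConformalLimit`.  The support item is the glue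

  `DepletionBound (inlined) → StrandShadow → IndependentStrandsJoin`,

a statement about FINITE sums on an arbitrary finite graph, instantiated on the boxes `Λ_N ⊂ ℤ³`.

Proof (for one strand configuration `F₁ ∈ 𝒯(a₀a₁)`, with `K₁ = {v | a₀ ↝_{F₁} v}` its `a₀`-cluster,
`t = tanh β`, `Z₂₃ = Z_t(a₂a₃)`, `g = ⟨σ_{a₂}σ_{a₃}⟩^free_G ≥ 0` and
`D(F₁) = ⟨σ_{a₂}σ_{a₃}⟩^free_{G ∖ K₁} ≥ 0` (GKS I, junk `+1` spins outside the volume included)):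

* if `a₂ ∈ K₁` or `a₃ ∈ K₁` then EVERY `F₂ ∈ 𝒯(a₂a₃)` joins `a₀` to `a₂` inside `F₁ ∪ F₂`
  (a `T`-join of a pair joins the pair, `reachable_of_mem_tJoins_pair`), so the joint sum of `F₁` is
  `t^{|F₁|} Z₂₃` and `t^{|F₁|} Z₂₃ g − t^{|F₁|} Z₂₃ D(F₁) ≤ J(F₁) g` trivially;
* otherwise every `F₂` whose `a₂`-cluster meets `K₁` joins `a₀` to `a₂`, so
  `J(F₁) ≥ t^{|F₁|} (Z₂₃ − Avoid(F₁))`, and the depletion bound `Avoid(F₁)·g ≤ Z₂₃·D(F₁)`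
  (hypothesis, with `S = K₁ ∌ a₂, a₃`) gives the same inequality `t^{|F₁|} Z₂₃ g − t^{|F₁|} Z₂₃ D(F₁) ≤ J(F₁) g`.
Summing over `F₁` and inserting the shadow hypothesis `Σ t^{|F₁|} D(F₁) ≤ (1 − c) Z₀₁ g` yields
`c Z₀₁ Z₂₃ g ≤ J g`.  If `g > 0` divide; if `g = 0` then `Z₂₃ = g · Z_t(∅) = 0`
(high-temperature expansion `isingCorr_free_eq_hteSum_div`, `hteSum_univ_eq_loopO1PartitionFunction`)
and the claim is `0 ≤ J`.

Contents: junk lemmas for the free finite-volume correlation with sites outside the volume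
(`spinProduct_glue_free_inter`, `isingCorr_free_eq_inter`, `isingCorr_free_nonneg`, adapted from the
standing disprover's work file of `StrandShadow`), `reachable_of_mem_tJoins_pair`,
`hteSum_univ_eq_loopO1PartitionFunction`, the finite-graph core `strandsJoin_of_shadow_of_depletion`,
and the item `shadowGivesJoin_proof : ShadowGivesJoin` verbatim.

Theorem-only file.  References: M. Aizenman, Comm. Math. Phys. 86 (1982), Lemma 9.3 [AizenmanCMP1982];
M. Aizenman, R. Fernández, J. Stat. Phys. 44 (1986), Claim (4.15) [AizenmanFernandezJSP1986];
H. Duminil-Copin, lectures on the Ising and Potts models (2017), §2.2.1 [DuminilCopinECM2018];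
U. T. Hansen, J. Jiang, F. R. Klausen, arXiv:2506.10765, §2 [HansenJiangKlausen2025].
-/

noncomputable section

open Finset SimpleGraph
open Literature.Probability.LatticeModels
open Literature.Combinatorics.SimpleGraph.CycleSpace
open Summit.CriticalPhenomena.Ising3DConformalLimit.Theses.FKParityRobustness (ShadowGivesJoin)

namespace Summit.CriticalPhenomena.Ising3DConformalLimit.Theorems

open scoped Classical

/-! ## Junk: the free finite-volume correlation ignores the sites outside the volume -/

section Junk

variable {V : Type*} (G : SimpleGraph V) [DecidableEq V] [G.LocallyFinite]

/-- Outside `Λ` the free boundary condition glues the constant `+1`, so `σ_A = σ_{A ∩ Λ}` on every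
glued configuration. -/
theorem spinProduct_glue_free_inter (Λ A : Finset V) (τ : Λ → ℤˣ) :
    spinProduct A (glue Λ τ .free) = spinProduct (A ∩ Λ) (glue Λ τ .free) := by
  -- adapted from Cruxes/StrandShadow/Disproof.lean (standing disprover, 2026-08-16)
  unfold spinProduct
  rw [← Finset.prod_filter_mul_prod_filter_not A (· ∈ Λ)]
  have h1 : A.filter (· ∈ Λ) = A ∩ Λ := by
    ext x; simp [Finset.mem_inter]
  have h2 : ∏ x ∈ A.filter (fun x => ¬ x ∈ Λ), spinAt x (glue Λ τ .free) = 1 := by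
    refine Finset.prod_eq_one fun x hx => ?_
    have hx' : x ∉ Λ := (Finset.mem_filter.1 hx).2
    simp [spinAt, glue_apply_of_notMem _ _ _ hx']
  rw [h1, h2, mul_one]

/-- **The junk mechanism.** `⟨σ_A⟩^free_{Λ} = ⟨σ_{A ∩ Λ}⟩^free_{Λ}`: sites of `A` outside the volume
are silently dropped (their spins are frozen to `+1`). -/
theorem isingCorr_free_eq_inter (Λ : Finset V) (β h : ℝ) (A : Finset V) :
    isingCorr G Λ β h .free A = isingCorr G Λ β h .free (A ∩ Λ) := by
  -- adapted from Cruxes/StrandShadow/Disproof.lean (standing disprover, 2026-08-16)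
  rw [isingCorr, isingCorr, isingExpect, isingExpect,
    integral_isingMeasure G Λ β h .free (measurable_spinProduct A),
    integral_isingMeasure G Λ β h .free (measurable_spinProduct (A ∩ Λ))]
  congr 1
  refine Finset.sum_congr rfl fun τ _ => ?_
  rw [spinProduct_glue_free_inter Λ A τ]

/-- **GKS I without the hypothesis `A ⊆ Λ`** (the outside part of `A` is junk `+1`):
`0 ≤ ⟨σ_A⟩^free_{Λ;β,h}` for `β, h ≥ 0`. -/
theorem isingCorr_free_nonneg (Λ : Finset V) {β h : ℝ} (hβ : 0 ≤ β) (hh : 0 ≤ h) (A : Finset V) :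
    0 ≤ isingCorr G Λ β h .free A := by
  rw [isingCorr_free_eq_inter]
  exact GKSInequalities.gks_one_holds G hβ hh (Or.inl rfl) Finset.inter_subset_right

end Junk

/-! ## Finite-graph facts: `T`-joins of a pair, the high-temperature sum on the whole graph -/

section General

variable {V : Type*} [Fintype V] [DecidableEq V] (G : SimpleGraph V) [DecidableRel G.Adj]

/-- **A `T`-join of a pair joins the pair**: if `∂F = {x, y}` then `x ↝ y` inside `F` (handshake in
the component of `x`, `exists_reachable_odd_of_odd`). -/
theorem reachable_of_mem_tJoins_pair {ω : Set (Sym2 V)} {x y : V} {F : Finset (Sym2 V)}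
    (hF : F ∈ tJoins G ω {x, y}) : (fromEdgeSet (↑F : Set (Sym2 V))).Reachable x y := by
  -- adapted from Cruxes/IndependentStrandsJoin/Disproof.lean (standing disprover, 2026-08-16)
  by_cases hxy : x = y
  · subst hxy; exact Reachable.refl _
  obtain ⟨hFG, -, hpar⟩ := (mem_tJoins G).1 hF
  have hFE : ∀ e ∈ F, ¬ e.IsDiag := fun e he =>
    G.not_isDiag_of_mem_edgeSet (mem_edgeFinset.1 (hFG he))
  have hx : Odd (edgeDeg F x) := (hpar x).2 (by simp)
  obtain ⟨w, hw, hreach, hwodd⟩ := exists_reachable_odd_of_odd F hFE hx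
  have hw' : w ∈ ({x, y} : Finset V) := (hpar w).1 hwodd
  rw [Finset.mem_insert, Finset.mem_singleton] at hw'
  rcases hw' with rfl | rfl
  · exact absurd rfl hw
  · exact hreach

/-- On the whole vertex set the high-temperature generating sum of the tree (`hteSum`, volume `univ`)
is the sourced loop-O(1) partition function: `g_univ(A) = Z^A_t(G)`. -/
theorem hteSum_univ_eq_loopO1PartitionFunction (t : ℝ) (A : Finset V) :
    hteSum G Finset.univ t A = loopO1PartitionFunction G t A := by
  rw [loopO1PartitionFunction_eq_sum_tJoins, hteSum]
  refine Finset.sum_congr ?_ fun _ _ => rfl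
  ext F
  have hE : edgesIn G (Finset.univ : Finset V) = G.edgeFinset := by
    ext e
    rw [mem_edgesIn_iff, mem_edgeFinset]
    simp
  simp only [Finset.mem_filter, Finset.mem_powerset, mem_tJoins, Set.subset_univ, true_and, hE,
    oddVerts, Finset.ext_iff, Finset.mem_univ]

/-- The free zero-field pair correlation on the whole graph through loop-O(1) partition functions:
`⟨σ_xσ_y⟩^free_G = Z^{xy}_{tanh β}(G) / Z^∅_{tanh β}(G)` (high-temperature expansion). -/
theorem isingCorr_univ_free_eq_loopO1_div (β : ℝ) (A : Finset V) :
    isingCorr G Finset.univ β 0 .free A =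
      loopO1PartitionFunction G (Real.tanh β) A / loopO1PartitionFunction G (Real.tanh β) ∅ := by
  rw [isingCorr_free_eq_hteSum_div G Finset.univ β (Finset.subset_univ A),
    hteSum_univ_eq_loopO1PartitionFunction, hteSum_univ_eq_loopO1PartitionFunction]

/-- **The finite-graph core of `ShadowGivesJoin`.**  On a finite graph, for `β ≥ 0`, `t = tanh β` and
four vertices `a`, the depletion bound for the pair `a₂a₃` (hypothesis `hD`, all `S ∌ a₂, a₃`) and the
shadow inequality with constant `c` (hypothesis `hS`) give the joining bound
`c · Z(a₀a₁) · Z(a₂a₃) ≤ Σ_{F₁} Σ_{F₂} t^{|F₁|+|F₂|} 1[a₀ ↝ a₂ in F₁ ∪ F₂]`. -/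
theorem strandsJoin_of_shadow_of_depletion {β c : ℝ} (hβ : 0 ≤ β) (a : Fin 4 → V)
    (hD : ∀ S : Finset V, a 2 ∉ S → a 3 ∉ S →
      (∑ F ∈ (tJoins G Set.univ {a 2, a 3}).filter (fun F : Finset (Sym2 V) =>
          ∀ v ∈ S, ¬ (SimpleGraph.fromEdgeSet (↑F : Set (Sym2 V))).Reachable (a 2) v),
          Real.tanh β ^ F.card) * isingCorr G Finset.univ β 0 .free {a 2, a 3} ≤
        loopO1PartitionFunction G (Real.tanh β) {a 2, a 3} *
          isingCorr G (Finset.univ \ S) β 0 .free {a 2, a 3})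
    (hS : ∑ F ∈ tJoins G Set.univ {a 0, a 1}, Real.tanh β ^ F.card *
        isingCorr G (Finset.univ.filter (fun v : V =>
          ¬ (SimpleGraph.fromEdgeSet (↑F : Set (Sym2 V))).Reachable (a 0) v)) β 0 .free {a 2, a 3} ≤
      (1 - c) * loopO1PartitionFunction G (Real.tanh β) {a 0, a 1} *
        isingCorr G Finset.univ β 0 .free {a 2, a 3}) :
    c * loopO1PartitionFunction G (Real.tanh β) {a 0, a 1} *
        loopO1PartitionFunction G (Real.tanh β) {a 2, a 3} ≤
      ∑ F₁ ∈ tJoins G Set.univ {a 0, a 1}, ∑ F₂ ∈ tJoins G Set.univ {a 2, a 3},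
        if (SimpleGraph.fromEdgeSet ((↑F₁ : Set (Sym2 V)) ∪ ↑F₂)).Reachable (a 0) (a 2)
        then Real.tanh β ^ (F₁.card + F₂.card) else 0 := by
  set t : ℝ := Real.tanh β with ht_def
  set T₁ := tJoins G Set.univ {a 0, a 1} with hT₁_def
  set T₂ := tJoins G Set.univ {a 2, a 3} with hT₂_def
  set Z₁ := loopO1PartitionFunction G t {a 0, a 1} with hZ₁_def
  set Z₂ := loopO1PartitionFunction G t {a 2, a 3} with hZ₂_def
  set g : ℝ := isingCorr G Finset.univ β 0 .free {a 2, a 3} with hg_def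
  have ht : 0 ≤ t := by
    rw [ht_def, Real.tanh_eq_sinh_div_cosh]
    exact div_nonneg (Real.sinh_nonneg_iff.2 hβ) (Real.cosh_pos _).le
  have hg : 0 ≤ g :=
    GKSInequalities.gks_one_holds G hβ le_rfl (Or.inl rfl) (Finset.subset_univ _)
  have hZ₁ : Z₁ = ∑ F ∈ T₁, t ^ #F := loopO1PartitionFunction_eq_sum_tJoins G t _
  have hZ₂ : Z₂ = ∑ F ∈ T₂, t ^ #F := loopO1PartitionFunction_eq_sum_tJoins G t _
  have hZ₂nn : 0 ≤ Z₂ := loopO1PartitionFunction_nonneg G ht _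
  -- the joint sum of one strand configuration, and the depleted correlation
  set J : Finset (Sym2 V) → ℝ := fun F₁ => ∑ F₂ ∈ T₂,
      if (SimpleGraph.fromEdgeSet ((↑F₁ : Set (Sym2 V)) ∪ ↑F₂)).Reachable (a 0) (a 2)
      then t ^ (#F₁ + #F₂) else 0 with hJ_def
  set D : Finset (Sym2 V) → ℝ := fun F₁ => isingCorr G (Finset.univ.filter (fun v : V =>
      ¬ (SimpleGraph.fromEdgeSet (↑F₁ : Set (Sym2 V))).Reachable (a 0) v)) β 0 .free {a 2, a 3}
    with hD_def
  have hJnn : ∀ F₁, 0 ≤ J F₁ := fun F₁ =>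
    Finset.sum_nonneg fun F₂ _ => by
      split_ifs
      · exact pow_nonneg ht _
      · exact le_rfl
  -- (**) the per-configuration inequality
  have key : ∀ F₁ ∈ T₁, t ^ #F₁ * Z₂ * g - t ^ #F₁ * Z₂ * D F₁ ≤ J F₁ * g := by
    intro F₁ _
    have hDnn : 0 ≤ D F₁ := isingCorr_free_nonneg G _ hβ le_rfl _
    by_cases hA : (SimpleGraph.fromEdgeSet (↑F₁ : Set (Sym2 V))).Reachable (a 0) (a 2) ∨
        (SimpleGraph.fromEdgeSet (↑F₁ : Set (Sym2 V))).Reachable (a 0) (a 3)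
    · -- sure join: the `a₀`-cluster already contains `a₂`, or `a₃` (joined to `a₂` by `F₂`)
      have hJeq : J F₁ = t ^ #F₁ * Z₂ := by
        simp only [hJ_def]
        rw [hZ₂, Finset.mul_sum]
        refine Finset.sum_congr rfl fun F₂ hF₂ => ?_
        rw [if_pos, pow_add]
        rcases hA with h | h
        · exact h.mono (fromEdgeSet_mono Set.subset_union_left)
        · exact (h.mono (fromEdgeSet_mono Set.subset_union_left)).trans
            ((reachable_of_mem_tJoins_pair G hF₂).symm.mono
              (fromEdgeSet_mono Set.subset_union_right))
      rw [hJeq]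
      have : 0 ≤ t ^ #F₁ * Z₂ * D F₁ := mul_nonneg (mul_nonneg (pow_nonneg ht _) hZ₂nn) hDnn
      linarith
    · push Not at hA
      obtain ⟨h2, h3⟩ := hA
      -- the `a₀`-cluster `S` avoids `a₂, a₃`: depletion bound with this `S`
      set S : Finset V := Finset.univ.filter (fun v : V =>
        (SimpleGraph.fromEdgeSet (↑F₁ : Set (Sym2 V))).Reachable (a 0) v) with hS_def
      have h2S : a 2 ∉ S := by simp [hS_def, h2]
      have h3S : a 3 ∉ S := by simp [hS_def, h3]
      have hcompl : Finset.univ \ S = Finset.univ.filter (fun v : V =>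
          ¬ (SimpleGraph.fromEdgeSet (↑F₁ : Set (Sym2 V))).Reachable (a 0) v) := by
        ext v
        simp [hS_def]
      have hDS := hD S h2S h3S
      rw [hcompl] at hDS
      -- `hDS : Avoid * g ≤ Z₂ * D F₁`
      set avoid : Finset (Sym2 V) → Prop := fun F =>
        ∀ v ∈ S, ¬ (SimpleGraph.fromEdgeSet (↑F : Set (Sym2 V))).Reachable (a 2) v with havoid_def
      have hsplit := Finset.sum_filter_add_sum_filter_not T₂ avoid (fun F => t ^ #F)
      -- every non-avoiding `F₂` joins `a₀` to `a₂` through the meeting vertex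
      have hJge : t ^ #F₁ * ∑ F ∈ T₂.filter (fun F => ¬ avoid F), t ^ #F ≤ J F₁ := by
        rw [Finset.mul_sum]
        calc ∑ F ∈ T₂.filter (fun F => ¬ avoid F), t ^ #F₁ * t ^ #F
            = ∑ F ∈ T₂.filter (fun F => ¬ avoid F),
                (if (SimpleGraph.fromEdgeSet ((↑F₁ : Set (Sym2 V)) ∪ ↑F)).Reachable (a 0) (a 2)
                  then t ^ (#F₁ + #F) else 0) := by
              refine Finset.sum_congr rfl fun F hF => ?_
              have hna : ¬ avoid F := (Finset.mem_filter.1 hF).2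
              simp only [havoid_def, not_forall, not_not] at hna
              obtain ⟨v, hv, hreach⟩ := hna
              have hv' : (SimpleGraph.fromEdgeSet (↑F₁ : Set (Sym2 V))).Reachable (a 0) v := by
                simpa [hS_def] using hv
              rw [if_pos, pow_add]
              exact (hv'.mono (fromEdgeSet_mono Set.subset_union_left)).trans
                (hreach.symm.mono (fromEdgeSet_mono Set.subset_union_right))
          _ ≤ J F₁ := by
              simp only [hJ_def]
              refine Finset.sum_le_sum_of_subset_of_nonneg (Finset.filter_subset _ _) ?_
              intro F _ _
              split_ifs
              · exact pow_nonneg ht _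
              · exact le_rfl
      have hrest : ∑ F ∈ T₂.filter (fun F => ¬ avoid F), t ^ #F =
          Z₂ - ∑ F ∈ T₂.filter avoid, t ^ #F := by
        rw [hZ₂]; linarith
      rw [hrest] at hJge
      have h1 := mul_le_mul_of_nonneg_left hDS (pow_nonneg ht #F₁)
      have h2 := mul_le_mul_of_nonneg_right hJge hg
      nlinarith [h1, h2, mul_nonneg (pow_nonneg ht #F₁) hg]
  -- sum (**) over the strand configurations
  have hsum : ∑ F₁ ∈ T₁, (t ^ #F₁ * Z₂ * g - t ^ #F₁ * Z₂ * D F₁) ≤ ∑ F₁ ∈ T₁, J F₁ * g :=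
    Finset.sum_le_sum key
  have hL : ∑ F₁ ∈ T₁, (t ^ #F₁ * Z₂ * g - t ^ #F₁ * Z₂ * D F₁) =
      Z₁ * Z₂ * g - Z₂ * ∑ F₁ ∈ T₁, t ^ #F₁ * D F₁ := by
    rw [Finset.sum_sub_distrib, hZ₁, Finset.sum_mul, Finset.sum_mul, Finset.mul_sum]
    congr 1
    refine Finset.sum_congr rfl fun _ _ => ?_
    ring
  have hR : ∑ F₁ ∈ T₁, J F₁ * g = (∑ F₁ ∈ T₁, J F₁) * g := (Finset.sum_mul _ _ _).symm
  rw [hL, hR] at hsum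
  -- the shadow hypothesis
  have hS' : Z₂ * ∑ F₁ ∈ T₁, t ^ #F₁ * D F₁ ≤ Z₂ * ((1 - c) * Z₁ * g) :=
    mul_le_mul_of_nonneg_left hS hZ₂nn
  have hmain : c * Z₁ * Z₂ * g ≤ (∑ F₁ ∈ T₁, J F₁) * g := by nlinarith [hsum, hS']
  -- conclude: divide by `g > 0`, or `g = 0 ⇒ Z₂ = 0`
  by_cases hg0 : g = 0
  · have hZ₂0 : Z₂ = 0 := by
      have hq := isingCorr_univ_free_eq_loopO1_div G β ({a 2, a 3} : Finset V)
      rw [← hg_def, hg0, eq_comm, div_eq_zero_iff] at hq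
      exact hq.resolve_right (loopO1PartitionFunction_empty_pos G ht).ne'
    rw [hZ₂0, mul_zero]
    exact Finset.sum_nonneg fun F₁ _ => hJnn F₁
  · have hgpos : 0 < g := lt_of_le_of_ne hg (Ne.symm hg0)
    exact le_of_mul_le_mul_right (by linarith [hmain]) hgpos

end General

/-! ## The item -/

/-- **`ShadowGivesJoin` (stmt-CriticalPhenomena-14649), verbatim**: the depletion bound (inlined) and
`StrandShadow` imply `IndependentStrandsJoin`, with the same constant `c` and the same `N₀(l)`:
instantiate `strandsJoin_of_shadow_of_depletion` on the box graph `(zdGraph 3).comap Subtype.val`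
over `↥(box 3 N)` at `β = β_c(3) ≥ 0` (`criticalBeta_nonneg`), the depletion hypothesis at the pair
`(a₂, a₃)`; the shadow instance is matched with `convert` (the route decl and the generic lemma carry
propositionally equal but syntactically different decidability instances in the depleted volume). -/
theorem shadowGivesJoin_proof : ShadowGivesJoin := by
  intro hD hS
  obtain ⟨c, hc, hS⟩ := hS
  refine ⟨c, hc, fun l hl => ?_⟩
  obtain ⟨N₀, hN⟩ := hS l hl
  refine ⟨N₀, fun N hN' a ha => ?_⟩
  have key := hN N hN' a ha
  refine strandsJoin_of_shadow_of_depletion (c := c)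
    ((zdGraph 3).comap (Subtype.val : ↥(box 3 N) → Site 3)) (criticalBeta_nonneg 3) a
    (fun S h2 h3 => hD _ _ _ (criticalBeta_nonneg 3) (a 2) (a 3) S h2 h3) ?_
  convert key using 5

end Summit.CriticalPhenomena.Ising3DConformalLimit.Theorems

end
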